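import Summits.KontsevichZagierPeriods.KontsevichZagierPeriods.Theses.IsogenyCertificates
import Summits.KontsevichZagierPeriods.KontsevichZagierPeriods.Theorems.EffectiveXMapChains.Negative.CountedTransfer
import Summits.KontsevichZagierPeriods.KontsevichZagierPeriods.Theorems.EffectiveXMapChains.Negative.Mechanism
import Summits.KontsevichZagierPeriods.KontsevichZagierPeriods.Theorems.EffectiveXMapChains.Negative.PeriodRep
import Summits.KontsevichZagierPeriods.KontsevichZagierPeriods.Theorems.EffectiveXMapChains.Negative.LimitValue
import Literature.NumberTheory.Transcendental.KZRelationsLE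
import Literature.NumberTheory.Transcendental.SemialgebraicMapsProofs
import Literature.ModelTheory.ExponentialFields.SemialgebraicComponents
import Literature.NumberTheory.EllipticCurves.XMapCertificate

/-!
# `EffectiveXMapChains` (stmt-KontsevichZagierPeriods-10664, route IsogenyCertificates) — line
`full-component-sheets`, stub `stub_coprimeReduction`

An x-rational isogeny datum `(f, g, c)` over `ℚ` — `W = f'g − fg' ≠ 0` and
`c²·g·(f³ + A'fg² + B'g³) = (X³ + AX + B)·W²` in `ℚ[X]` — may be taken with `f, g` COPRIME, with
the same multiplier `c` and without increasing `max (deg f) (deg g)`: divide `f, g` by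
`d = gcd(f, g)` (`ℚ[X]` is a Euclidean domain), `f = d·f₁`, `g = d·g₁`; then
`W(f, g) = d²·W(f₁, g₁)` (`xMapWronskian_mul_mul`), the identity for `(f, g)` is `d⁴` times the one
for `(f₁, g₁)` and `d⁴` cancels in the domain `ℚ[X]` (`xMapIdentity_cancel`), and `f₁ ∣ f`,
`g₁ ∣ g` with `f, g ≠ 0` bound the degrees (`Polynomial.natDegree_le_of_dvd`). This is
`HasXMapCertificate.exists_isCoprime` of `Literature/NumberTheory/EllipticCurves/XMapCertificate`
with the degree bound added.
-/

noncomputable section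

open Polynomial Set MeasureTheory
open Literature.NumberTheory.Transcendental Literature.ModelTheory.ExponentialFields
open Literature.NumberTheory.EllipticCurves
open Summit.KontsevichZagierPeriods.IsogenyCertificates.EffectiveXMapChainsNegative

namespace Summit.KontsevichZagierPeriods.IsogenyCertificates.EffectiveXMapChainsLine

/-- **Stub (coprime reduction).** Every datum `(f, g, c)` (`W = f'g − fg' ≠ 0`,
`c²·g·(f³ + A'fg² + B'g³) = (X³ + AX + B)·W²`) can be replaced by a datum `(f₁, g₁, c)` with
`IsCoprime f₁ g₁` and `max (deg f₁) (deg g₁) ≤ max (deg f) (deg g)`: divide by `gcd(f, g)`; the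
Wronskian scales by the square of the common factor and the identity by its fourth power, which
cancels in `ℚ[X]`. [folklore] -/
theorem stub_coprimeReduction (A B A' B' : ℤ) (f g : ℚ[X]) (c : ℚ) (hW : derivative f * g - f * derivative g ≠ 0) (hI : C (c ^ 2) * g * (f ^ 3 + C (A' : ℚ) * f * g ^ 2 + C (B' : ℚ) * g ^ 3) = (X ^ 3 + C (A : ℚ) * X + C (B : ℚ)) * (derivative f * g - f * derivative g) ^ 2) : ∃ f₁ g₁ : ℚ[X], IsCoprime f₁ g₁ ∧ derivative f₁ * g₁ - f₁ * derivative g₁ ≠ 0 ∧ C (c ^ 2) * g₁ * (f₁ ^ 3 + C (A' : ℚ) * f₁ * g₁ ^ 2 + C (B' : ℚ) * g₁ ^ 3) = (X ^ 3 + C (A : ℚ) * X + C (B : ℚ)) * (derivative f₁ * g₁ - f₁ * derivative g₁) ^ 2 ∧ max f₁.natDegree g₁.natDegree ≤ max f.natDegree g.natDegree := by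
  classical
  letI := EuclideanDomain.gcdMonoid ℚ[X]
  -- `g ≠ 0` and `f ≠ 0` are forced by `W ≠ 0`
  have hg : g ≠ 0 := g_ne_zero_of_wronskian_ne_zero hW
  have hf : f ≠ 0 := by
    rintro rfl
    exact hW (by simp)
  have hd : GCDMonoid.gcd f g ≠ 0 := gcd_ne_zero_of_right hg
  have hcop := isCoprime_div_gcd_div_gcd (p := f) hg
  obtain ⟨f₁, hf₁⟩ := GCDMonoid.gcd_dvd_left f g
  obtain ⟨g₁, hg₁⟩ := GCDMonoid.gcd_dvd_right f g
  generalize GCDMonoid.gcd f g = d at hd hcop hf₁ hg₁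
  subst hf₁ hg₁
  rw [mul_div_cancel_left₀ f₁ hd, mul_div_cancel_left₀ g₁ hd] at hcop
  -- the Wronskian and the identity, rephrased through `xMapWronskian`
  have hw₁ : xMapWronskian (d * f₁) (d * g₁) ≠ 0 := hW
  have H₁ : (X ^ 3 + C (A : ℚ) * X + C (B : ℚ)) * xMapWronskian (d * f₁) (d * g₁) ^ 2 =
      C (c ^ 2) * (d * g₁) * ((d * f₁) ^ 3 + C (A' : ℚ) * (d * f₁) * (d * g₁) ^ 2 +
        C (B' : ℚ) * (d * g₁) ^ 3) := hI.symm
  rw [xMapWronskian_mul_mul] at hw₁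
  have hW₁ : xMapWronskian f₁ g₁ ≠ 0 := right_ne_zero_of_mul hw₁
  have hI₁ := xMapIdentity_cancel hd H₁
  refine ⟨f₁, g₁, hcop, hW₁, hI₁.symm, ?_⟩
  -- degrees: `f₁ ∣ d * f₁ = f ≠ 0`, `g₁ ∣ d * g₁ = g ≠ 0`
  exact max_le_max (natDegree_le_of_dvd (dvd_mul_left f₁ d) hf)
    (natDegree_le_of_dvd (dvd_mul_left g₁ d) hg)

end Summit.KontsevichZagierPeriods.IsogenyCertificates.EffectiveXMapChainsLine
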